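import Summits.KontsevichZagierPeriods.KontsevichZagierPeriods.Theorems.HermiteRigidityIslandComplementBoxDuplication

/-!
# `ReductionRigidity` (stmt-KontsevichZagierPeriods-3407), line `Sketch`, cycle 2 of lead c7 (growth G11,
# the ALL-WEIGHT duplication join): the weight-`i` duplication as a chain of two moves (`stub_dupMoveGen`)

Route `KontsevichZagierPeriods/HermiteRigidity`, crux `ReductionRigidity` (stmt-3407); registered
sub-goal stub of the all-weight duplication join island (levels `N`, `−N`, `N²` of an integer `N ≥ 2`,
in every weight `i ≥ 1`). For every rational `ε`,

  `[□ⁱ, ε/(N² − ∏ pₗ)] − [□ⁱ, 2^{i−1}ε/(N − ∏ pₗ)] − [□ⁱ, 2^{i−1}ε/((−N) − ∏ pₗ)] ∈ KZ.relations`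

(values: the weight-`i` duplication `Liᵢ(1/N²) = 2^{i−1}(Liᵢ(1/N) + Liᵢ(−1/N))`). It is a chain of TWO
moves on the closed cube `□ⁱ = [0,1]ⁱ`: the change of variables along the squaring self-map
`Φ(u) = (uₗ²)ₗ` of the cube (rule 2; `rel_coordPow_two` in dimension `i`, Jacobian
`|det Φ'(u)| = 2ⁱ ∏ uₗ`, and `∏ uₗ² = (∏ uₗ)²`) turns `[□ⁱ, ε/(N² − ∏ pₗ)]` into
`[□ⁱ, 2ⁱ ε U/(N² − U²)]` (`U = ∏ uₗ`), and ONE integrand additivity (rule 1b) realises the partial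
fraction `2ⁱ ε U/(N² − U²) = 2^{i−1}ε/(N − U) + 2^{i−1}ε/((−N) − U)`; the quantified representations
are bridged to the regular-rational cube representations by congruence. This generalises the
weight-one (`stub_dupJoinWeightOne`) and weight-two (`stub_dupJoinScaled`) instances to every weight.

References: M. Kontsevich, D. Zagier, *Periods* (2001), §1.2 rules (1), (2)
[cite: KontsevichZagier2001, §1.2]. No definitions are introduced.
-/

noncomputable section

open MeasureTheory Set MvPolynomial

namespace Summit.KontsevichZagierPeriods.HermiteRigidity.ReductionRigidity

open Literature.NumberTheory.Transcendental
open Literature.NumberTheory.Transcendental.KZ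

/-- The four weight-`i` integrands `ε/(N² − U)`, `2ⁱεU/(N² − U²)`, `2^{i−1}ε/(N − U)`,
`2^{i−1}ε/((−N) − U)` (`U = ∏ xₗ`, `N ≥ 2`) are regular rational functions on `□ⁱ`: regular rational
functions `R, W, S, T` with these values on the closed cube exist (denominators `≥ 3`, `≥ 3`, `≥ 1`,
`≤ −2` on `[0,1]ⁱ`). [cite: KontsevichZagier2001, §1.1] -/
theorem exists_rfun_dupMoveGen {N : ℕ} (hN : 2 ≤ N) (i : ℕ) (ε : ℚ) :
    ∃ R W S T : RFun i,
      (∀ x ∈ cube i, R.fn x = (ε : ℝ) / ((N : ℝ) ^ 2 - ∏ l, x l)) ∧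
      (∀ x ∈ cube i, W.fn x =
        (2 : ℝ) ^ i * (ε : ℝ) * (∏ l, x l) / ((N : ℝ) ^ 2 - (∏ l, x l) ^ 2)) ∧
      (∀ x ∈ cube i, S.fn x = ((2 ^ (i - 1) * ε : ℚ) : ℝ) / ((N : ℝ) - ∏ l, x l)) ∧
      (∀ x ∈ cube i, T.fn x = ((2 ^ (i - 1) * ε : ℚ) : ℝ) / ((-(N : ℝ)) - ∏ l, x l)) := by
  have h2 : (2:ℝ) ≤ (N:ℝ) := by exact_mod_cast hN
  -- on the closed cube `0 ≤ ∏ xₗ ≤ 1`, and `aeval x (∏ Xₗ) = ∏ xₗ`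
  have hu : ∀ x ∈ cube i, 0 ≤ ∏ l, x l ∧ ∏ l, x l ≤ 1 := fun x hx =>
    ⟨Finset.prod_nonneg fun l _ => (hx l).1, Finset.prod_le_one (fun l _ => (hx l).1) fun l _ => (hx l).2⟩
  have aeval_prod_X_eq : ∀ x : Fin i → ℝ, aeval x (∏ l, X l : MvPolynomial (Fin i) ℚ) = ∏ l, x l :=
    fun x => by
      rw [map_prod]
      exact Finset.prod_congr rfl fun l _ => aeval_X x l
  have hR : ∀ x ∈ cube i,
      aeval x (C ((N:ℚ) ^ 2) - ∏ l, X l : MvPolynomial (Fin i) ℚ) ≠ 0 := by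
    intro x hx
    have hU := hu x hx
    rw [map_sub, aeval_prod_X_eq, aeval_C, eq_ratCast, Rat.cast_pow, Rat.cast_natCast]
    nlinarith
  have hW : ∀ x ∈ cube i,
      aeval x (C ((N:ℚ) ^ 2) - (∏ l, X l) ^ 2 : MvPolynomial (Fin i) ℚ) ≠ 0 := by
    intro x hx
    have hU := hu x hx
    rw [map_sub, map_pow (aeval x), aeval_prod_X_eq, aeval_C, eq_ratCast, Rat.cast_pow,
      Rat.cast_natCast]
    nlinarith
  have hS : ∀ x ∈ cube i, aeval x (C (N:ℚ) - ∏ l, X l : MvPolynomial (Fin i) ℚ) ≠ 0 := by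
    intro x hx
    have hU := hu x hx
    rw [map_sub, aeval_prod_X_eq, aeval_C, eq_ratCast, Rat.cast_natCast]
    linarith
  have hT : ∀ x ∈ cube i, aeval x (C (-(N:ℚ)) - ∏ l, X l : MvPolynomial (Fin i) ℚ) ≠ 0 := by
    intro x hx
    have hU := hu x hx
    rw [map_sub, aeval_prod_X_eq, aeval_C, eq_ratCast, Rat.cast_neg, Rat.cast_natCast]
    linarith
  refine ⟨⟨C ε, _, hR⟩, ⟨C (2 ^ i * ε) * ∏ l, X l, _, hW⟩, ⟨C (2 ^ (i - 1) * ε), _, hS⟩,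
    ⟨C (2 ^ (i - 1) * ε), _, hT⟩, fun x _ => ?_, fun x _ => ?_, fun x _ => ?_, fun x _ => ?_⟩
  · rw [RFun.fn_apply, map_sub, aeval_prod_X_eq, aeval_C, aeval_C, eq_ratCast, eq_ratCast,
      Rat.cast_pow, Rat.cast_natCast]
  · rw [RFun.fn_apply, map_mul, map_sub, map_pow (aeval x), aeval_prod_X_eq, aeval_C, aeval_C,
      eq_ratCast, eq_ratCast, Rat.cast_pow, Rat.cast_natCast, Rat.cast_mul, Rat.cast_pow,
      Rat.cast_ofNat]
  · rw [RFun.fn_apply, map_sub, aeval_prod_X_eq, aeval_C, aeval_C, eq_ratCast, eq_ratCast,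
      Rat.cast_natCast]
  · rw [RFun.fn_apply, map_sub, aeval_prod_X_eq, aeval_C, aeval_C, eq_ratCast, eq_ratCast,
      Rat.cast_neg, Rat.cast_natCast]

/-- **Stub `stub_dupMoveGen`** (sub-goal of crux `ReductionRigidity`, stmt-3407, line `Sketch`, lead c7
cycle 2, growth G11: the all-weight duplication join island): **the weight-`i` duplication as a chain
of two moves.** For every integer `N ≥ 2`, every weight `i ≥ 1`, every rational `ε` and any
representations `r, s, t` on `[0,1]ⁱ` with the printed integrands on it,
`[□ⁱ, ε/(N² − ∏ pₗ)] − [□ⁱ, 2^{i−1}ε/(N − ∏ pₗ)] − [□ⁱ, 2^{i−1}ε/((−N) − ∏ pₗ)] ∈ KZ.relations`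
(values `ε Liᵢ(1/N²)`, `2^{i−1}ε Liᵢ(1/N)`, `2^{i−1}ε Liᵢ(−1/N)`). Moves: the squaring change of
variables `p = (uₗ²)ₗ` (`rel_coordPow_two` in dimension `i`:
`[□ⁱ, ε/(N² − ∏ pₗ)] ≡ [□ⁱ, 2ⁱεU/(N² − U²)]`, `U = ∏ uₗ`, `|det Φ'| = 2ⁱ U`) and one integrand
additivity for the partial fraction `2ⁱεU/(N² − U²) = 2^{i−1}ε/(N − U) + 2^{i−1}ε/((−N) − U)`; the
quantified representations are bridged to the cube representations by congruence.
[cite: KontsevichZagier2001, §1.2 rules (1), (2)] -/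
theorem stub_dupMoveGen : ∀ (N : ℕ), 2 ≤ N → ∀ (i : ℕ), 1 ≤ i → ∀ (ε : ℚ) (r s t : IntegralRep i),
    r.domain = cube i → EqOn r.integrand (fun p => (ε : ℝ) / ((N : ℝ) ^ 2 - ∏ l, p l)) (cube i) →
    s.domain = cube i → EqOn s.integrand (fun p => ((2 ^ (i - 1) * ε : ℚ) : ℝ) / ((N : ℝ) - ∏ l, p l)) (cube i) →
    t.domain = cube i → EqOn t.integrand (fun p => ((2 ^ (i - 1) * ε : ℚ) : ℝ) / ((-(N : ℝ)) - ∏ l, p l)) (cube i) →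
    KZ.of r - KZ.of s - KZ.of t ∈ KZ.relations := by
  intro N hN i hi ε r s t hr hri hs hsi ht hti
  have h2 : (2:ℝ) ≤ (N:ℝ) := by exact_mod_cast hN
  have h2i : (2:ℝ) ^ i = 2 * 2 ^ (i - 1) := by
    rw [← pow_succ', Nat.sub_add_cancel hi]
  obtain ⟨R, W, S, T, hR, hW, hS, hT⟩ := exists_rfun_dupMoveGen hN i ε
  -- congruences with the cube representations
  have er : KZ.of r - KZ.of R.rep ∈ KZ.relations :=
    KZ.of_sub_of_mem_relations_of_eqOn (by rw [RFun.rep_domain, hr]) fun x hx => by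
      rw [hr] at hx
      rw [RFun.rep_integrand, hri hx, hR x hx]
  have es : KZ.of s - KZ.of S.rep ∈ KZ.relations :=
    KZ.of_sub_of_mem_relations_of_eqOn (by rw [RFun.rep_domain, hs]) fun x hx => by
      rw [hs] at hx
      rw [RFun.rep_integrand, hsi hx, hS x hx]
  have et : KZ.of t - KZ.of T.rep ∈ KZ.relations :=
    KZ.of_sub_of_mem_relations_of_eqOn (by rw [RFun.rep_domain, ht]) fun x hx => by
      rw [ht] at hx
      rw [RFun.rep_integrand, hti hx, hT x hx]
  -- the squaring move `[W] ≡ [R]` (`p = (uₗ²)ₗ`, `|det Φ'| = 2ⁱ ∏ uₗ`)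
  have eWR : KZ.of W.rep - KZ.of R.rep ∈ KZ.relations := by
    refine rel_coordPow_two R W fun x hx => ?_
    have hx2 : BoxIntegral.coordPow 2 x ∈ cube i := by
      rw [← image_coordPow_two_cube i]; exact mem_image_of_mem _ hx
    rw [hW x hx, hR _ hx2]
    simp only [BoxIntegral.coordPow_apply]
    rw [Finset.prod_pow]
    ring
  -- the partial fraction `[W] ≡ [S + T]`
  have eWST : KZ.of W.rep - KZ.of (S.add T).rep ∈ KZ.relations := by
    refine RFun.rel_of_eqOn fun x hx => ?_
    have h0 : 0 ≤ ∏ l, x l := Finset.prod_nonneg fun l _ => (hx l).1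
    have h1 : ∏ l, x l ≤ 1 := Finset.prod_le_one (fun l _ => (hx l).1) fun l _ => (hx l).2
    have hm : (N:ℝ) - ∏ l, x l ≠ 0 := by linarith
    have hp : (-(N:ℝ)) - ∏ l, x l ≠ 0 := by linarith
    rw [RFun.fn_add hx, hW x hx, hS x hx, hT x hx, h2i]
    have hsq : (N:ℝ) ^ 2 - (∏ l, x l) ^ 2 = -(((N:ℝ) - ∏ l, x l) * ((-(N:ℝ)) - ∏ l, x l)) := by
      ring
    rw [hsq]
    push_cast
    field_simp
    ring
  have eST := RFun.rel_add S T
  have e : KZ.of r - KZ.of s - KZ.of t =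
      (KZ.of r - KZ.of R.rep) - (KZ.of W.rep - KZ.of R.rep) + (KZ.of W.rep - KZ.of (S.add T).rep)
        + (KZ.of (S.add T).rep - KZ.of S.rep - KZ.of T.rep)
        - (KZ.of s - KZ.of S.rep) - (KZ.of t - KZ.of T.rep) := by abel
  rw [e]
  exact KZ.relations.sub_mem (KZ.relations.sub_mem (KZ.relations.add_mem
    (KZ.relations.add_mem (KZ.relations.sub_mem er eWR) eWST) eST) es) et

end Summit.KontsevichZagierPeriods.HermiteRigidity.ReductionRigidity

end
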